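import Literature.Probability.LatticeModels.KilledWalkLaplacian
import Literature.Probability.LatticeModels.BoundaryEstimate
import Literature.Probability.LatticeModels.ExteriorLatticePath
import HarnessLib

/-!
# The weak Beurling estimate for the edge-killed walk of a Jordan domain

Topic `Literature/Probability/LatticeModels`; continuation of `KilledWalkLaplacian.lean`. For the
simple random walk run along the edges of `Ω_δ = discreteDomainGraph D δ` (the discretisation of a
Jordan domain `D`) and killed at its first step that is not an `Ω_δ`-edge, a function `h ≥ 0` that
is (sub)harmonic for this walk (`IsKilledSubharmonicOn`) near a boundary point `p` of `D` is small
near `p` compared with its size at distance `R`: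

* `JordanDomain.killedSubharmonic_weakBeurling` — for `R, ε > 0` there is `r > 0` such that for all
  small meshes `δ`, every `h` with `0 ≤ h ≤ M` at the vertices of `Ω_δ` within `R` of `p` and
  `h ≤ killedAvg Ω_δ h` there satisfies `h ≤ ε M` at the vertices within `r` of `p`.

This is the edge-killed form of Smirnov's weak Beurling estimate (Smirnov 2010, App. B,
Lemma B.2; Kesten 1987; Chelkak 2016, Lemma 2.13; Chelkak–Wan 2021, §3.2 "uniform weak-Beurling
estimate"), obtained from the tree's site version: the truncated zero extension of a nonnegative
killed-subharmonic function is lattice-subharmonic (`isLatticeSubharmonicOn_truncate`: the killed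
average drops nonnegative terms), and the comparison-plus-weak-Beurling lemma `sub_le_eta_add_pow`
(`BoundaryEstimate.lean`, built on `weakBeurling_of_holeFree`) applies inside the hole-free set
`(ExtConn D δ)ᶜ` with an exterior site near `p` (`eventually_exists_extConn_near`). The same
transfer is carried out, for functions on the finite volume, in the Summit file
`…AvoidanceLimitWeakBeurlingTransfer.lean`; the present statement is the library form (functions on
`ℤ²`, hypotheses only within `R` of `p`). Everything is proved.

## References

* S. Smirnov, *Conformal invariance in random cluster models. I*, Ann. of Math. 172 (2010),
  App. B, Lemma B.2. [Smirnov2010]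
* D. Chelkak, *Robust discrete complex analysis: a toolbox*, Ann. Probab. 44 (2016), Lemma 2.13.
  [Chelkak2016]
* D. Chelkak, Y. Wan, Electron. J. Probab. 26 (2021), §3.2. [ChelkakWan2021]
-/

noncomputable section

open scoped Classical Topology
open Set Metric Filter

namespace Literature.Probability.LatticeModels

/-! ### Truncated zero extension of a killed-subharmonic function -/

/-- **The truncated zero extension of a nonnegative killed-subharmonic function is
lattice-subharmonic.** If `h ≤ killedAvg Gr h` on `T`, every `Gr`-neighbour (in a lattice
direction) of a site of `T` lies in `S₀ ⊇ T`, and `h ≥ 0` on `S₀`, then `𝟙_{S₀} h` is subharmonic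
on `T` for the nearest-neighbour Laplacian of `ℤ²` (the killed average keeps the `S₀`-values of the
`Gr`-neighbours and drops only nonnegative terms). [folklore] -/
theorem isLatticeSubharmonicOn_truncate {Gr : SimpleGraph (Site 2)} {h : Site 2 → ℝ} {S₀ T : Set (Site 2)}
    (hsub : IsKilledSubharmonicOn Gr h T)
    (hnbr : ∀ v ∈ T, ∀ e : SRW.Dir 2, Gr.Adj v (v + SRW.stepVec e) → v + SRW.stepVec e ∈ S₀)
    (hTS : T ⊆ S₀) (hnn : ∀ w ∈ S₀, 0 ≤ h w) :
    IsLatticeSubharmonicOn (fun w => if w ∈ S₀ then h w else 0) T := by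
  intro v hv
  set u : Site 2 → ℝ := fun w => if w ∈ S₀ then h w else 0 with hu
  have hu0 : ∀ w, 0 ≤ u w := fun w => by
    simp only [hu]; split_ifs with hw
    · exact hnn w hw
    · exact le_rfl
  have key : killedAvg Gr h v ≤ 4⁻¹ * ∑ k : Fin 4, u (v + cornerUnit k) := by
    rw [killedAvg, ← sum_dir_eq_sum_cornerUnit (fun w => u (v + w))]
    refine mul_le_mul_of_nonneg_left (Finset.sum_le_sum fun e _ => ?_) (by norm_num)
    split_ifs with he
    · simp only [hu, if_pos (hnbr v hv e he)]; exact le_rfl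
    · exact hu0 _
  have huv : u v = h v := by simp only [hu, if_pos (hTS hv)]
  rw [latticeLaplacian_eq, huv]
  linarith [hsub v hv]

/-! ### The estimate -/

/-- Sites within `ρ` of `p` lie in a box of integer radius `k` about a site `c` with mesh point
within `δ` of `p`, as soon as `ρ + δ ≤ (k + 1) δ`... precisely: coordinates differ by at most `k`
when `dist < ρ + δ ≤ δ (k + 1)`. [folklore] -/
theorem abs_sub_le_natCast_of_dist_meshPoint_lt {δ : ℝ} (hδ : 0 < δ) {y c : Site 2} {k : ℕ}
    (h : dist (meshPoint δ y) (meshPoint δ c) < δ * (k + 1)) (i : Fin 2) : |y i - c i| ≤ (k : ℤ) := by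
  have h1 := abs_sub_mul_le_dist_meshPoint' δ c y i
  rw [abs_of_pos hδ] at h1
  have h3 : |((y i : ℤ) : ℝ) - c i| < k + 1 := lt_of_mul_lt_mul_left (h1.trans_lt h) hδ.le
  have h4 : |y i - c i| < (k : ℤ) + 1 := by exact_mod_cast h3
  exact Int.lt_add_one_iff.1 h4

/-- Mesh points of a box of integer radius `n` about `c` are within `2 n δ` of the mesh point of `c`.
[folklore] -/
theorem dist_meshPoint_le_of_mem_sqBox {δ : ℝ} (hδ : 0 ≤ δ) {c x : Site 2} {n : ℤ}
    (hx : x ∈ WeakBeurling.sqBox c n) : dist (meshPoint δ x) (meshPoint δ c) ≤ δ * (2 * n) := by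
  rw [WeakBeurling.mem_sqBox] at hx
  have hsup : DiscreteDobrushin.supNear c n x := fun i => by
    fin_cases i
    · exact hx.1
    · exact hx.2
  exact DiscreteDobrushin.dist_meshPoint_le_of_supNear hδ hsup

/-- **Weak Beurling estimate for the edge-killed walk of a Jordan domain** (Hölder-type smallness at
a boundary point). Let `D` be a Jordan domain, `p ∈ ∂D`, `R > 0`, `ε > 0`. There is `r > 0` such
that for all sufficiently small meshes `δ > 0` the following holds: if `h : ℤ² → ℝ` satisfies
`0 ≤ h z ≤ M` at every vertex `z` of `Ω_δ = discreteDomainGraph D δ` with mesh point within `R` of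
`p`, and `h z ≤ killedAvg Ω_δ h z` at those vertices (subharmonicity for the walk killed at its first
non-`Ω_δ` step — e.g. harmonicity), then `h z ≤ ε M` at every vertex within `r` of `p`. The values
of `h` elsewhere are irrelevant. (Smirnov 2010, Lemma B.2; Chelkak 2016, Lemma 2.13; for the
edge-killed walk: Chelkak–Wan 2021, §3.2.) [cite: Smirnov2010, App. B Lemma B.2] -/
theorem _root_.Literature.Probability.RandomPlanarGeometry.JordanDomain.killedSubharmonic_weakBeurling
    (D : RandomPlanarGeometry.JordanDomain) {p : ℂ} (hp : p ∈ frontier D.carrier) {R ε : ℝ}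
    (hR : 0 < R) (hε : 0 < ε) :
    ∃ r > 0, ∀ᶠ δ in 𝓝[>] (0 : ℝ), ∀ (h : Site 2 → ℝ) (M : ℝ),
      (∀ z ∈ meshDomain D.carrier δ, dist (meshPoint δ z) p < R → 0 ≤ h z ∧ h z ≤ M) →
      IsKilledSubharmonicOn (discreteDomainGraph D.carrier δ) h
        {z | z ∈ meshDomain D.carrier δ ∧ dist (meshPoint δ z) p < R} →
      ∀ z ∈ meshDomain D.carrier δ, dist (meshPoint δ z) p < r → h z ≤ ε * M := by
  -- the number of scales `J` and the radius `ρ₀ = R / (40 · 5^J)`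
  obtain ⟨J, hJε⟩ := exists_pow_lt_of_lt_one hε
    (show 1 - maneuverConst < 1 by linarith [maneuverConst_pos])
  have hN1 : (1 : ℝ) ≤ 5 ^ J := one_le_pow₀ (by norm_num)
  obtain ⟨ρ₀, hρ₀pos, hρ₀⟩ : ∃ ρ₀ : ℝ, 0 < ρ₀ ∧ 20 * 5 ^ J * ρ₀ = R / 2 :=
    ⟨R / (40 * 5 ^ J), by positivity, by field_simp; ring⟩
  have hρ₀R : ρ₀ < R := by nlinarith
  refine ⟨ρ₀, hρ₀pos, ?_⟩
  have hsmall : ∀ᶠ δ in 𝓝[>] (0 : ℝ), δ < R / (40 * 5 ^ J + 12) :=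
    nhdsWithin_le_nhds (Iio_mem_nhds (by positivity))
  filter_upwards [hsmall, (self_mem_nhdsWithin : ∀ᶠ δ in 𝓝[>] (0 : ℝ), 0 < δ),
    eventually_exists_extConn_near D hp hρ₀pos] with δ hδs hδ0 hF
  have hδ : (0 : ℝ) < δ := hδ0
  have hδR : (40 * 5 ^ J + 12) * δ < R := by
    rw [lt_div_iff₀ (by positivity)] at hδs; linarith
  obtain ⟨F₀, hF₀d, hF₀e⟩ := hF
  intro h M hbd hsub z hzΩ hz
  obtain ⟨hz0, hzM⟩ := hbd z hzΩ (hz.trans hρ₀R)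
  -- degenerate bound `M ≤ 0`
  rcases le_or_gt M 0 with hM0 | hMpos
  · have hM : M = 0 := le_antisymm hM0 (hz0.trans hzM)
    rw [hM, mul_zero]; linarith
  -- the centre and the unit scale `k₀` with `ρ₀ ≤ k₀ δ < ρ₀ + δ`
  obtain ⟨c, hcp⟩ : ∃ c : Site 2, dist (meshPoint δ c) p ≤ δ := ⟨_, dist_meshPoint_nearestSite_le hδ p⟩
  obtain ⟨k₀, hk₀pos, hk₁, hk₂⟩ : ∃ k₀ : ℕ, 0 < k₀ ∧ ρ₀ ≤ k₀ * δ ∧ (k₀ : ℝ) * δ < ρ₀ + δ := by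
    refine ⟨⌈ρ₀ / δ⌉₊, Nat.ceil_pos.2 (by positivity), ?_, ?_⟩
    · have h1 := Nat.le_ceil (ρ₀ / δ)
      rwa [div_le_iff₀ hδ] at h1
    · have h1 := Nat.ceil_lt_add_one (show (0 : ℝ) ≤ ρ₀ / δ by positivity)
      calc ((⌈ρ₀ / δ⌉₊ : ℕ) : ℝ) * δ < (ρ₀ / δ + 1) * δ := mul_lt_mul_of_pos_right h1 hδ
        _ = ρ₀ + δ := by field_simp
  set Rb : ℤ := 10 * 5 ^ J * (k₀ : ℤ) with hRb
  -- sites within `ρ₀` of `p` are in the small box `mB c k₀` and in the big box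
  have hnear : ∀ y : Site 2, dist (meshPoint δ y) p < ρ₀ → y ∈ mB c k₀ ∧ y ∈ WeakBeurling.sqBox c Rb := by
    intro y hy
    have hyc : dist (meshPoint δ y) (meshPoint δ c) < δ * (k₀ + 1) :=
      calc dist (meshPoint δ y) (meshPoint δ c) ≤ dist (meshPoint δ y) p + dist (meshPoint δ c) p :=
            dist_triangle_right _ _ _
        _ < ρ₀ + δ := add_lt_add_of_lt_of_le hy hcp
        _ ≤ δ * (k₀ + 1) := by nlinarith
    have hcoord := abs_sub_le_natCast_of_dist_meshPoint_lt hδ hyc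
    have hRk : (k₀ : ℤ) ≤ Rb := by
      have h5 : (1 : ℤ) ≤ 5 ^ J := one_le_pow₀ (by norm_num)
      have hk0z : (0 : ℤ) ≤ k₀ := by exact_mod_cast hk₀pos.le
      rw [hRb]; nlinarith
    refine ⟨?_, ?_⟩
    · rw [mB_eq_sqBox, WeakBeurling.mem_sqBox]
      exact ⟨(hcoord 0).trans (by linarith), (hcoord 1).trans (by linarith)⟩
    · rw [WeakBeurling.mem_sqBox]
      exact ⟨(hcoord 0).trans hRk, (hcoord 1).trans hRk⟩
  -- every site of the big box, and each of its lattice neighbours, is within `R` of `p`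
  have hfar : ∀ x ∈ WeakBeurling.sqBox c Rb, dist (meshPoint δ x) p < R - 4 * δ := by
    intro x hx
    have h1 := dist_meshPoint_le_of_mem_sqBox hδ.le hx
    rw [hRb] at h1
    push_cast at h1
    have h2 : (5 : ℝ) ^ J * (k₀ * δ) ≤ 5 ^ J * (ρ₀ + δ) := mul_le_mul_of_nonneg_left hk₂.le (by positivity)
    have h3 : dist (meshPoint δ x) (meshPoint δ c) ≤ R / 2 + 20 * 5 ^ J * δ := by
      have h4 : δ * (2 * (10 * 5 ^ J * (k₀ : ℝ))) = 20 * (5 ^ J * (k₀ * δ)) := by ring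
      rw [h4] at h1
      have h5 : 20 * ((5 : ℝ) ^ J * (ρ₀ + δ)) = R / 2 + 20 * 5 ^ J * δ := by rw [mul_add, mul_add, ← hρ₀]; ring
      linarith
    calc dist (meshPoint δ x) p ≤ dist (meshPoint δ x) (meshPoint δ c) + dist (meshPoint δ c) p :=
          dist_triangle _ _ _
      _ ≤ R / 2 + 20 * 5 ^ J * δ + δ := add_le_add h3 hcp
      _ < R - 4 * δ := by linarith
  have hstep : ∀ (v : Site 2) (e : SRW.Dir 2),
      dist (meshPoint δ (v + SRW.stepVec e)) p ≤ dist (meshPoint δ v) p + 2 * δ := by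
    intro v e
    have h1 : dist (meshPoint δ (v + SRW.stepVec e)) (meshPoint δ v) ≤ δ * (2 * ((1 : ℤ) : ℝ)) := by
      refine DiscreteDobrushin.dist_meshPoint_le_of_supNear hδ.le fun i => ?_
      simp only [Pi.add_apply, add_sub_cancel_left]
      exact SRW.abs_stepVec_apply_le e i
    push_cast at h1
    linarith [dist_triangle (meshPoint δ (v + SRW.stepVec e)) (meshPoint δ v) p]
  -- the sets: `S₀` (bounds available), `T` (subharmonicity used), the truncation `u`
  obtain ⟨S₀, hS₀⟩ : ∃ S₀ : Set (Site 2),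
      S₀ = {v | v ∈ meshDomain D.carrier δ ∧ dist (meshPoint δ v) p < R} := ⟨_, rfl⟩
  have memS₀ : ∀ {v}, v ∈ S₀ ↔ v ∈ meshDomain D.carrier δ ∧ dist (meshPoint δ v) p < R := by
    rw [hS₀]; exact Iff.rfl
  rw [← hS₀] at hsub
  obtain ⟨T, hT⟩ : ∃ T : Set (Site 2),
      T = {v | v ∈ meshDomain D.carrier δ ∧ dist (meshPoint δ v) p < R - 2 * δ} := ⟨_, rfl⟩
  have memT : ∀ {v}, v ∈ T ↔ v ∈ meshDomain D.carrier δ ∧ dist (meshPoint δ v) p < R - 2 * δ := by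
    rw [hT]; exact Iff.rfl
  have hTS : T ⊆ S₀ := fun v hv => memS₀.2 ⟨(memT.1 hv).1, by linarith [(memT.1 hv).2, hδ]⟩
  set u : Site 2 → ℝ := fun w => if w ∈ S₀ then M⁻¹ * h w else 0 with hu
  have hsub' : IsKilledSubharmonicOn (discreteDomainGraph D.carrier δ) (fun w => M⁻¹ * h w) T := by
    intro v hv
    rw [killedAvg_const_mul]
    exact mul_le_mul_of_nonneg_left (hsub v (hTS hv)) (inv_nonneg.2 hMpos.le)
  have husub : IsLatticeSubharmonicOn u T := by
    refine isLatticeSubharmonicOn_truncate hsub' (fun v hv e he => ?_) hTS (fun w hw => ?_)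
    · refine memS₀.2 ⟨(discreteDomainGraph_adj_iff.1 he).2.2, ?_⟩
      linarith [hstep v e, (memT.1 hv).2]
    · exact mul_nonneg (inv_nonneg.2 hMpos.le) (hbd w (memS₀.1 hw).1 (memS₀.1 hw).2).1
  have hu1 : ∀ w, u w ≤ 1 := fun w => by
    simp only [hu]; split_ifs with hw
    · rw [inv_mul_le_iff₀ hMpos, mul_one]; exact (hbd w (memS₀.1 hw).1 (memS₀.1 hw).2).2
    · exact zero_le_one
  -- hole-free certificate
  have hTK : T ∩ WeakBeurling.sqBox c Rb ⊆ (ExtConn D.carrier δ)ᶜ := fun v hv =>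
    not_mem_extConn_of_mem (meshDomain_subset_meshVertices _ _ (memT.1 hv.1).1)
  have hF₀K : F₀ ∉ (ExtConn D.carrier δ)ᶜ := fun h' => h' hF₀e
  have hfin : (T ∩ WeakBeurling.sqBox c Rb).Finite :=
    (WeakBeurling.sqBox_finite c Rb).subset Set.inter_subset_right
  obtain ⟨hzc, hzR⟩ := hnear z hz
  have hρ₀40 : 40 * ρ₀ ≤ R := by nlinarith [hρ₀, hN1, hρ₀pos.le]
  have hδ52 : 52 * δ < R := by nlinarith [hδR, hN1, hδ.le]
  have hzT : z ∈ T := memT.2 ⟨hzΩ, by linarith [hz]⟩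
  have hJR : 10 * 5 ^ J * (k₀ : ℤ) ≤ Rb := le_rfl
  have key := sub_le_eta_add_pow (S₀ := T) (Bl := WeakBeurling.sqBox c Rb) (K := (ExtConn D.carrier δ)ᶜ)
    husub le_rfl
    (fun w hwT hw => by
      split_ifs with hwB
      · -- `w` in the big box but not in `T`: then `w ∉ meshDomain`, so `u w = 0`
        have hwΩ : w ∉ meshDomain D.carrier δ := fun hwΩ => hwT (memT.2 ⟨hwΩ, by linarith [hfar w hwB]⟩)
        have hwS : w ∉ S₀ := fun hwS => hwΩ (memS₀.1 hwS).1
        simp only [hu, if_neg hwS]; exact le_rfl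
      · exact hu1 w)
    (fun w _ => hu1 w) hfin (holeFree_compl_extConn D.carrier δ) hTK c hk₀pos hF₀K (hnear F₀ hF₀d).1
    subset_rfl J hJR ⟨hzT, hzR⟩ hzc
  rw [zero_add] at key
  have huz : u z = M⁻¹ * h z := by simp only [hu, if_pos (hTS hzT)]
  rw [huz, inv_mul_le_iff₀ hMpos] at key
  calc h z ≤ M * (1 - maneuverConst) ^ J := key
    _ ≤ M * ε := mul_le_mul_of_nonneg_left hJε.le hMpos.le
    _ = ε * M := mul_comm _ _

end Literature.Probability.LatticeModels
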